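import Mathlib.Analysis.Calculus.ContDiff.Bounds
import Mathlib.Analysis.Calculus.InverseFunctionTheorem.ApproximatesLinearOn
import Mathlib.Analysis.Calculus.MeanValue
import Mathlib.Data.Nat.Choose.Bounds
import Literature.Analysis.Calculus.ScaledCutoffFamily
import HarnessLib

/-!
# Gluing affine maps close to the identity by bump functions, with `Cᵏ` bounds

Topic `Literature/Analysis/Calculus` (namespace `Literature.Analysis.Calculus`). The standard
partition-of-unity gluing of finitely many LOCAL models to a GLOBAL map (Lee, *Introduction to
Smooth Manifolds*, 2nd ed., Lemma 2.26 and Prop. 13.3's proof pattern; Hirsch, *Differential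
Topology*, §2.2), in the quantitative affine form used to re-anchor coordinate charts: on a real
normed space `E` with a "position" projection `P : E →L[ℝ] S` to a finite-dimensional space `S`,
given centres `X i ∈ S` that are `16ϱ`-separated and affine maps `y ↦ L i y + w i` that are
`a`-close to the identity (`‖L i − id‖ ≤ a`, `‖L i y + w i − y‖ ≤ a ϱ` on the `4ϱ`-neighbourhood
of the `i`-th centre inside a region `Ω`), the map
`Θ y = y + Σ i ψ i y • (L i y + w i − y)`, `ψ i = φ_{X i, 2ϱ} ∘ P` (scaled cut-offs of
`ScaledCutoffFamily.lean`), is smooth, equals `y ↦ L j y + w j` near every point whose position is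
within `ϱ` of `X j`, moves points by `≤ K a ϱ` and has `‖DΘ − id‖ ≤ K a`, `‖DⁿΘ‖ ≤ K a`
(`2 ≤ n ≤ k + 1`) on `Ω`, for a constant `K = K(k, #ι)` (`exists_affine_bump_gluing`).

Auxiliary, also folklore:
* `norm_iteratedFDeriv_one_of_hasFDerivAt`, `iteratedFDeriv_add_two_of_hasFDerivAt`,
  `norm_iteratedFDeriv_le_of_hasFDerivAt`, `norm_iteratedFDeriv_succ_le_of_hasFDerivAt` — the jets
  of a map with constant derivative (an affine map);
* `isOpenEmbedding_restrict_of_norm_fderiv_sub_id_le` — a `C¹` map with `‖DΘ − id‖ ≤ 1/2` on an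
  open convex set restricts to an open embedding there (inverse function theorem in the
  `ApproximatesLinearOn` form of Mathlib).

No definitions; everything is proved. Mathlib: `norm_iteratedFDeriv_smul_le` (Leibniz bound),
`ContinuousLinearMap.iteratedFDeriv_comp_right`, `ApproximatesLinearOn.toOpenPartialHomeomorph`,
`OpenPartialHomeomorph.isOpenEmbedding_restrict`, `Convex.lipschitzOnWith_of_nnnorm_fderiv_le`.

## References

* J. M. Lee, *Introduction to Smooth Manifolds*, 2nd ed., Springer GTM 218 (2013), Lemma 2.26,
  Thm. 4.5 (inverse function theorem). [folklore]
* M. W. Hirsch, *Differential Topology*, Springer GTM 33 (1976), §2.2. [folklore]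
-/

noncomputable section

open Set Metric Filter Function
open scoped Topology ContDiff NNReal

namespace Literature.Analysis.Calculus

variable {E F : Type*} [NormedAddCommGroup E] [NormedSpace ℝ E] [NormedAddCommGroup F]
  [NormedSpace ℝ F]

/-! ### Jets of a map with constant derivative -/

/-- A map with constant derivative `M` has `‖D¹f(x)‖ = ‖M‖`. [folklore] -/
theorem norm_iteratedFDeriv_one_of_hasFDerivAt {f : E → F} {M : E →L[ℝ] F}
    (hf : ∀ x, HasFDerivAt f M x) (x : E) : ‖iteratedFDeriv ℝ 1 f x‖ = ‖M‖ := by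
  rw [← norm_iteratedFDeriv_fderiv, norm_iteratedFDeriv_zero, (hf x).fderiv]

/-- A map with constant derivative has vanishing jets of every order `≥ 2`. [folklore] -/
theorem iteratedFDeriv_add_two_of_hasFDerivAt {f : E → F} {M : E →L[ℝ] F}
    (hf : ∀ x, HasFDerivAt f M x) (n : ℕ) (x : E) : iteratedFDeriv ℝ (n + 2) f x = 0 := by
  have hfd : (fun y ↦ fderiv ℝ f y) = fun _ ↦ M := funext fun y ↦ (hf y).fderiv
  rw [iteratedFDeriv_succ_eq_comp_right, Function.comp_apply, hfd, iteratedFDeriv_succ_const,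
    Pi.zero_apply]
  exact (continuousMultilinearCurryRightEquiv' ℝ (n + 1) E F).symm.map_zero

/-- Jets of a map with constant derivative `M`: `‖Dⁿf(x)‖ ≤ ‖f x‖ + ‖M‖` for every `n`.
[folklore] -/
theorem norm_iteratedFDeriv_le_of_hasFDerivAt {f : E → F} {M : E →L[ℝ] F}
    (hf : ∀ x, HasFDerivAt f M x) (n : ℕ) (x : E) :
    ‖iteratedFDeriv ℝ n f x‖ ≤ ‖f x‖ + ‖M‖ := by
  rcases n with _ | _ | n
  · rw [norm_iteratedFDeriv_zero]
    exact le_add_of_nonneg_right (norm_nonneg _)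
  · rw [norm_iteratedFDeriv_one_of_hasFDerivAt hf]
    exact le_add_of_nonneg_left (norm_nonneg _)
  · rw [iteratedFDeriv_add_two_of_hasFDerivAt hf, norm_zero]
    positivity

/-- Jets of a map with constant derivative `M`: `‖Dⁿ⁺¹f(x)‖ ≤ ‖M‖`. [folklore] -/
theorem norm_iteratedFDeriv_succ_le_of_hasFDerivAt {f : E → F} {M : E →L[ℝ] F}
    (hf : ∀ x, HasFDerivAt f M x) (n : ℕ) (x : E) :
    ‖iteratedFDeriv ℝ (n + 1) f x‖ ≤ ‖M‖ := by
  rcases n with _ | n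
  · rw [norm_iteratedFDeriv_one_of_hasFDerivAt hf]
  · rw [iteratedFDeriv_add_two_of_hasFDerivAt hf, norm_zero]
    exact norm_nonneg _

/-! ### Open embedding from a derivative close to the identity -/

/-- **Inverse function theorem, embedding form.** If `Θ : E → E` (`E` complete) is differentiable
on an open convex set `Ω` with `‖DΘ(x) − id‖ ≤ 1/2` there, then `Θ|Ω` is an open embedding
(`Θ − id` is `½`-Lipschitz on `Ω`, so `Θ` approximates the identity in Mathlib's sense
`ApproximatesLinearOn`, which yields an open partial homeomorphism with source `Ω`).
Lee 2013, Thm. 4.5 / Cor. C.36. [folklore] -/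
theorem isOpenEmbedding_restrict_of_norm_fderiv_sub_id_le [CompleteSpace E] {Θ : E → E}
    {Ω : Set E} (hΩ : IsOpen Ω) (hΩc : Convex ℝ Ω) (hd : ∀ x ∈ Ω, DifferentiableAt ℝ Θ x)
    (hb : ∀ x ∈ Ω, ‖fderiv ℝ Θ x - ContinuousLinearMap.id ℝ E‖ ≤ 1 / 2) :
    Topology.IsOpenEmbedding (Ω.restrict Θ) := by
  have hlip : LipschitzOnWith (1 / 2 : ℝ≥0) (fun x ↦ Θ x - x) Ω := by
    refine hΩc.lipschitzOnWith_of_nnnorm_fderiv_le (fun x hx ↦ (hd x hx).sub differentiableAt_id)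
      fun x hx ↦ ?_
    have h1 : HasFDerivAt (fun y ↦ Θ y - y) (fderiv ℝ Θ x - ContinuousLinearMap.id ℝ E) x :=
      (hd x hx).hasFDerivAt.sub (hasFDerivAt_id x)
    rw [h1.fderiv, ← NNReal.coe_le_coe, coe_nnnorm]
    simpa using hb x hx
  have hA : ApproximatesLinearOn Θ
      ((ContinuousLinearEquiv.refl ℝ E : E ≃L[ℝ] E) : E →L[ℝ] E) Ω (1 / 2 : ℝ≥0) := by
    refine LipschitzOnWith.approximatesLinearOn ?_
    have : (Θ - ⇑((ContinuousLinearEquiv.refl ℝ E : E ≃L[ℝ] E) : E →L[ℝ] E)) =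
        fun x ↦ Θ x - x := by
      ext x; simp
    rwa [this]
  have hc : Subsingleton E ∨
      (1 / 2 : ℝ≥0) < ‖(((ContinuousLinearEquiv.refl ℝ E).symm : E ≃L[ℝ] E) : E →L[ℝ] E)‖₊⁻¹ := by
    rcases subsingleton_or_nontrivial E with h | h
    · exact Or.inl h
    · right
      rw [ContinuousLinearEquiv.refl_symm, ContinuousLinearEquiv.coe_refl, ← NNReal.coe_lt_coe,
        NNReal.coe_inv, coe_nnnorm, ContinuousLinearMap.norm_id]
      norm_num
  exact (hA.toOpenPartialHomeomorph Θ Ω hc hΩ).isOpenEmbedding_restrict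

/-! ### Gluing affine maps by scaled cut-offs -/

section Gluing

variable {S : Type*} [NormedAddCommGroup S] [NormedSpace ℝ S] [HasContDiffBump S]
  [FiniteDimensional ℝ S]

/-- **Gluing affine maps close to the identity by a partition of unity, with `Cᵏ` bounds.**
For every order `k` and finite index type `ι` there is a constant `K ≥ 1` such that: whenever
`P : E →L[ℝ] S` has norm `≤ 1`, the centres `X i ∈ S` are pairwise `16ϱ`-separated (`ϱ ≥ 1`),
and the affine maps `y ↦ L i y + w i` satisfy `‖L i − id‖ ≤ a` and `‖L i y + w i − y‖ ≤ a ϱ` for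
`y ∈ Ω` with `‖P y − X i‖ ≤ 4ϱ`, there is a smooth `Θ : E → E` of the form
`Θ y = y + Σ i cᵢ(y) • (L i y + w i − y)` which on `Ω` satisfies `‖DΘ − id‖ ≤ K a`,
`‖Θ y − y‖ ≤ K a ϱ`, `‖DⁿΘ‖ ≤ K a` for `2 ≤ n ≤ k + 1`, and which coincides with
`y ↦ L j y + w j` to first order (value and derivative) at every point whose position `P y` is
within `ϱ` of `X j`. The `cᵢ` are the scaled cut-offs `φ_{X i, 2ϱ} ∘ P` of
`exists_smooth_cutoff_family` (supports pairwise disjoint by the separation); the bounds are the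
Leibniz rule `norm_iteratedFDeriv_smul_le` with `‖Dᵐ cᵢ‖ ≤ C_m (2ϱ)⁻ᵐ`. Lee 2013, Lemma 2.26;
Hirsch 1976, §2.2. [folklore] -/
theorem exists_affine_bump_gluing (k : ℕ) (ι : Type*) [Fintype ι] :
    ∃ K : ℝ, 1 ≤ K ∧ ∀ (P : E →L[ℝ] S) (X : ι → S) (ϱ a : ℝ) (L : ι → E →L[ℝ] E) (w : ι → E)
      (Ω : Set E), ‖P‖ ≤ 1 → 1 ≤ ϱ → 0 ≤ a → (∀ i j, i ≠ j → 16 * ϱ ≤ ‖X i - X j‖) →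
      (∀ i, ‖L i - ContinuousLinearMap.id ℝ E‖ ≤ a) →
      (∀ i, ∀ y ∈ Ω, ‖P y - X i‖ ≤ 4 * ϱ → ‖L i y + w i - y‖ ≤ a * ϱ) →
      ∃ Θ : E → E, ContDiff ℝ ∞ Θ ∧
        (∀ y, ∃ c : ι → ℝ, Θ y = y + ∑ i, c i • (L i y + w i - y)) ∧
        (∀ y ∈ Ω, ‖fderiv ℝ Θ y - ContinuousLinearMap.id ℝ E‖ ≤ K * a ∧
          ‖Θ y - y‖ ≤ K * a * ϱ ∧
          ∀ n, 2 ≤ n → n ≤ k + 1 → ‖iteratedFDeriv ℝ n Θ y‖ ≤ K * a) ∧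
        (∀ j y, ‖P y - X j‖ ≤ ϱ → fderiv ℝ Θ y = L j ∧ Θ y = L j y + w j) := by
  obtain ⟨φ, C, hC0, hφ⟩ := exists_smooth_cutoff_family (E := S)
  -- one constant dominating the cut-off jets of order `≤ k + 1`
  set Cs : ℝ := ∑ i ∈ Finset.range (k + 2), C i with hCs_def
  have hCs0 : 0 ≤ Cs := Finset.sum_nonneg fun i _ ↦ hC0 i
  have hCle : ∀ n, n ≤ k + 1 → C n ≤ Cs := fun n hn ↦
    Finset.single_le_sum (f := C) (fun i _ ↦ hC0 i) (Finset.mem_range.2 (by omega))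
  set M₀ : ℝ := (k + 2) * 2 ^ (k + 1) * (1 + 2 * Cs) with hM₀_def
  have hM₀1 : 1 ≤ M₀ := by
    have h1 : (1 : ℝ) ≤ (k + 2) := by norm_cast; omega
    have h2 : (1 : ℝ) ≤ 2 ^ (k + 1) := one_le_pow₀ (by norm_num)
    have h3 : (1 : ℝ) ≤ 1 + 2 * Cs := by linarith
    calc (1 : ℝ) = 1 * 1 * 1 := by ring
      _ ≤ (k + 2) * 2 ^ (k + 1) * (1 + 2 * Cs) :=
        mul_le_mul (mul_le_mul h1 h2 zero_le_one (by positivity)) h3 zero_le_one (by positivity)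
  refine ⟨(Fintype.card ι + 1) * M₀, ?_, ?_⟩
  · have : (1 : ℝ) ≤ Fintype.card ι + 1 := by norm_cast; omega
    nlinarith
  intro P X ϱ a L w Ω hP hϱ ha hsep hL hnear
  have hϱ0 : 0 < ϱ := one_pos.trans_le hϱ
  have hcardK : (Fintype.card ι : ℝ) ≤ (Fintype.card ι + 1) * M₀ := by
    have : (0 : ℝ) ≤ Fintype.card ι := by positivity
    nlinarith
  /- the cut-offs `ψ i = φ_{X i, 2ϱ} ∘ P` -/
  set ψ : ι → E → ℝ := fun i y ↦ φ (X i) (2 * ϱ) (P y) with hψ_def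
  have hφi := fun i ↦ hφ (X i) (2 * ϱ) (by positivity)
  have hψs : ∀ i, ContDiff ℝ ∞ (ψ i) := fun i ↦ (hφi i).1.comp P.contDiff
  have hψ0 : ∀ i y, 0 ≤ ψ i y := fun i y ↦ (hφi i).2.1 _
  have hψ1 : ∀ i y, ψ i y ≤ 1 := fun i y ↦ (hφi i).2.2.1 _
  have hψone : ∀ i y, ‖P y - X i‖ ≤ 2 * ϱ → ψ i y = 1 := fun i y h ↦
    (hφi i).2.2.2.1 _ (by rwa [dist_eq_norm])
  have hψzero : ∀ i y, 4 * ϱ ≤ ‖P y - X i‖ → ψ i y = 0 := fun i y h ↦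
    (hφi i).2.2.2.2.1 _ (by rw [dist_eq_norm]; linarith)
  have hψjet0 : ∀ i n, 1 ≤ n → ∀ y, 4 * ϱ < ‖P y - X i‖ → iteratedFDeriv ℝ n (ψ i) y = 0 := by
    intro i n hn y hy
    have h := (hφi i).2.2.2.2.2.2.2.1 n hn (P y) (Or.inr (by rw [dist_eq_norm]; linarith))
    change iteratedFDeriv ℝ n (φ (X i) (2 * ϱ) ∘ P) y = 0
    rw [P.iteratedFDeriv_comp_right (hφi i).1 y (by exact_mod_cast le_top), h]
    ext m
    simp
  have hψjet : ∀ i n, 1 ≤ n → n ≤ k + 1 → ∀ y, ‖iteratedFDeriv ℝ n (ψ i) y‖ ≤ Cs / ϱ := by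
    intro i n hn hnk y
    change ‖iteratedFDeriv ℝ n (φ (X i) (2 * ϱ) ∘ P) y‖ ≤ _
    rw [P.iteratedFDeriv_comp_right (hφi i).1 y (by exact_mod_cast le_top)]
    refine (ContinuousMultilinearMap.norm_compContinuousLinearMap_le _ _).trans ?_
    have h1 := (hφi i).2.2.2.2.2.2.2.2.2 n (P y)
    have hP1 : ∏ _i : Fin n, ‖P‖ ≤ 1 := by
      rw [Finset.prod_const, Finset.card_univ, Fintype.card_fin]
      exact pow_le_one₀ (norm_nonneg _) hP
    have h2 : ϱ ≤ (2 * ϱ) ^ n :=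
      calc ϱ ≤ 2 * ϱ := by linarith
        _ ≤ (2 * ϱ) ^ n := le_self_pow₀ (by linarith) (by omega)
    calc ‖iteratedFDeriv ℝ n (φ (X i) (2 * ϱ)) (P y)‖ * ∏ _i : Fin n, ‖P‖
        ≤ C n / (2 * ϱ) ^ n * 1 :=
          mul_le_mul h1 hP1 (by positivity) (div_nonneg (hC0 n) (by positivity))
      _ ≤ C n / ϱ := by rw [mul_one]; exact div_le_div_of_nonneg_left (hC0 n) hϱ0 h2
      _ ≤ Cs / ϱ := div_le_div_of_nonneg_right (hCle n hnk) hϱ0.le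
  /- the affine corrections `G i y = L i y + w i - y` -/
  set G : ι → E → E := fun i y ↦ L i y + w i - y with hG_def
  have hGd : ∀ i y, HasFDerivAt (G i) (L i - ContinuousLinearMap.id ℝ E) y := fun i y ↦
    ((L i).hasFDerivAt.add_const (w i)).sub (hasFDerivAt_id y)
  have hGs : ∀ i, ContDiff ℝ ∞ (G i) := fun i ↦
    ((L i).contDiff.add contDiff_const).sub contDiff_id
  have hGjet : ∀ i n y, ‖iteratedFDeriv ℝ n (G i) y‖ ≤ ‖G i y‖ + a := fun i n y ↦
    (norm_iteratedFDeriv_le_of_hasFDerivAt (hGd i) n y).trans (by gcongr; exact hL i)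
  have hGjet1 : ∀ i n y, ‖iteratedFDeriv ℝ (n + 1) (G i) y‖ ≤ a := fun i n y ↦
    (norm_iteratedFDeriv_succ_le_of_hasFDerivAt (hGd i) n y).trans (hL i)
  /- the glued map -/
  have hTs : ∀ i, ContDiff ℝ ∞ (fun y ↦ ψ i y • G i y) := fun i ↦ (hψs i).smul (hGs i)
  have hsum_s : ContDiff ℝ ∞ (fun y ↦ ∑ i, ψ i y • G i y) := ContDiff.sum fun i _ ↦ hTs i
  set Θ : E → E := fun y ↦ y + ∑ i, ψ i y • G i y with hΘ_def
  /- Leibniz: the jets of one term `ψ i • G i` of order `1 ≤ n ≤ k + 1` on `Ω` -/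
  set Q : ℝ := a * (1 + 2 * Cs) with hQ_def
  have hQ0 : 0 ≤ Q := by positivity
  have haQ : a ≤ Q := by rw [hQ_def]; nlinarith
  have hterm : ∀ i, ∀ y ∈ Ω, ∀ n, 1 ≤ n → n ≤ k + 1 →
      ‖iteratedFDeriv ℝ n (fun y ↦ ψ i y • G i y) y‖ ≤ (k + 2) * 2 ^ (k + 1) * Q := by
    intro i y hy n hn1 hnk
    refine (norm_iteratedFDeriv_smul_le (hψs i) (hGs i) y (by exact_mod_cast le_top)).trans ?_
    have hbound : ∀ m ∈ Finset.range (n + 1),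
        (n.choose m : ℝ) * ‖iteratedFDeriv ℝ m (ψ i) y‖ * ‖iteratedFDeriv ℝ (n - m) (G i) y‖ ≤
          2 ^ (k + 1) * Q := by
      intro m hm
      have hmn : m ≤ n := Nat.lt_succ_iff.mp (Finset.mem_range.mp hm)
      have hchoose : (n.choose m : ℝ) ≤ 2 ^ (k + 1) :=
        calc (n.choose m : ℝ) ≤ ((2 ^ n : ℕ) : ℝ) := by exact_mod_cast Nat.choose_le_two_pow n m
          _ = (2 : ℝ) ^ n := by push_cast; ring
          _ ≤ 2 ^ (k + 1) := pow_le_pow_right₀ (by norm_num) hnk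
      have hprod : ‖iteratedFDeriv ℝ m (ψ i) y‖ * ‖iteratedFDeriv ℝ (n - m) (G i) y‖ ≤ Q := by
        rcases le_or_gt ‖P y - X i‖ (4 * ϱ) with hny | hfy
        · -- near the `i`-th centre
          rcases Nat.eq_zero_or_pos m with rfl | hm1
          · obtain ⟨n', rfl⟩ : ∃ n', n = n' + 1 := ⟨n - 1, by omega⟩
            rw [norm_iteratedFDeriv_zero, Nat.sub_zero, Real.norm_eq_abs, abs_of_nonneg (hψ0 i y)]
            calc ψ i y * ‖iteratedFDeriv ℝ (n' + 1) (G i) y‖ ≤ 1 * a :=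
                mul_le_mul (hψ1 i y) (hGjet1 i n' y) (norm_nonneg _) zero_le_one
              _ ≤ Q := by rwa [one_mul]
          · calc ‖iteratedFDeriv ℝ m (ψ i) y‖ * ‖iteratedFDeriv ℝ (n - m) (G i) y‖
                ≤ Cs / ϱ * (a * ϱ + a) :=
                  mul_le_mul (hψjet i m hm1 (hmn.trans hnk) y)
                    ((hGjet i _ y).trans (by gcongr; exact hnear i y hy hny)) (norm_nonneg _)
                    (by positivity)
              _ = Cs * a + Cs * a / ϱ := by field_simp
              _ ≤ Cs * a + Cs * a := by gcongr; exact div_le_self (by positivity) hϱ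
              _ = Q - a := by rw [hQ_def]; ring
              _ ≤ Q := by linarith
        · -- far from the `i`-th centre the cut-off factor vanishes identically
          have h0 : ‖iteratedFDeriv ℝ m (ψ i) y‖ = 0 := by
            rcases Nat.eq_zero_or_pos m with rfl | hm1
            · rw [norm_iteratedFDeriv_zero, hψzero i y hfy.le, norm_zero]
            · rw [hψjet0 i m hm1 y hfy, norm_zero]
          rw [h0, zero_mul]
          exact hQ0
      calc (n.choose m : ℝ) * ‖iteratedFDeriv ℝ m (ψ i) y‖ * ‖iteratedFDeriv ℝ (n - m) (G i) y‖
          = (n.choose m : ℝ) *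
              (‖iteratedFDeriv ℝ m (ψ i) y‖ * ‖iteratedFDeriv ℝ (n - m) (G i) y‖) := by ring
        _ ≤ 2 ^ (k + 1) * Q := mul_le_mul hchoose hprod (by positivity) (by positivity)
    refine (Finset.sum_le_sum hbound).trans ?_
    rw [Finset.sum_const, Finset.card_range, nsmul_eq_mul]
    have : ((n + 1 : ℕ) : ℝ) ≤ k + 2 := by norm_cast; omega
    calc ((n + 1 : ℕ) : ℝ) * (2 ^ (k + 1) * Q) ≤ (k + 2) * (2 ^ (k + 1) * Q) :=
          mul_le_mul_of_nonneg_right this (by positivity)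
      _ = _ := by ring
  have hsumterm : ∀ y ∈ Ω, ∀ n, 1 ≤ n → n ≤ k + 1 →
      ∑ i, ‖iteratedFDeriv ℝ n (fun y ↦ ψ i y • G i y) y‖ ≤ (Fintype.card ι + 1) * M₀ * a := by
    intro y hy n hn1 hnk
    refine (Finset.sum_le_sum fun i _ ↦ hterm i y hy n hn1 hnk).trans ?_
    rw [Finset.sum_const, Finset.card_univ, nsmul_eq_mul]
    have h1 : (Fintype.card ι : ℝ) * ((k + 2) * 2 ^ (k + 1) * Q) = Fintype.card ι * (M₀ * a) := by
      rw [hM₀_def, hQ_def]; ring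
    rw [h1]
    have hM₀a : 0 ≤ M₀ * a := mul_nonneg (zero_le_one.trans hM₀1) ha
    nlinarith [hM₀a]
  refine ⟨Θ, contDiff_id.add hsum_s, fun y ↦ ⟨fun i ↦ ψ i y, rfl⟩, fun y hy ↦ ⟨?_, ?_, ?_⟩, ?_⟩
  · -- first derivative
    have hD : HasFDerivAt Θ (ContinuousLinearMap.id ℝ E +
        ∑ i, fderiv ℝ (fun y ↦ ψ i y • G i y) y) y :=
      (hasFDerivAt_id y).fun_add
        (HasFDerivAt.fun_sum fun i _ ↦ ((hTs i).differentiable (by simp) y).hasFDerivAt)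
    rw [hD.fderiv, add_sub_cancel_left]
    refine (norm_sum_le _ _).trans ((Finset.sum_le_sum fun i _ ↦ ?_).trans
      (hsumterm y hy 1 le_rfl (by omega)))
    rw [← norm_iteratedFDeriv_fderiv, norm_iteratedFDeriv_zero]
  · -- displacement
    have hdisp : ∀ i, ‖ψ i y • G i y‖ ≤ a * ϱ := by
      intro i
      rcases le_or_gt ‖P y - X i‖ (4 * ϱ) with hny | hfy
      · rw [norm_smul, Real.norm_eq_abs, abs_of_nonneg (hψ0 i y)]
        calc ψ i y * ‖G i y‖ ≤ 1 * (a * ϱ) :=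
            mul_le_mul (hψ1 i y) (hnear i y hy hny) (norm_nonneg _) zero_le_one
          _ = a * ϱ := one_mul _
      · rw [hψzero i y hfy.le, zero_smul, norm_zero]; positivity
    show ‖y + ∑ i, ψ i y • G i y - y‖ ≤ _
    rw [add_sub_cancel_left]
    refine (norm_sum_le _ _).trans ((Finset.sum_le_sum fun i _ ↦ hdisp i).trans ?_)
    rw [Finset.sum_const, Finset.card_univ, nsmul_eq_mul, mul_assoc]
    exact mul_le_mul_of_nonneg_right hcardK (by positivity)
  · -- higher jets
    intro n hn2 hnk
    obtain ⟨n', rfl⟩ : ∃ n', n = n' + 2 := ⟨n - 2, by omega⟩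
    have hid0 : iteratedFDeriv ℝ (n' + 2) (fun y : E ↦ y) y = 0 :=
      iteratedFDeriv_add_two_of_hasFDerivAt (f := fun y : E ↦ y) (fun x ↦ hasFDerivAt_id x) n' y
    have hN : ∀ m : ℕ, (m : WithTop ℕ∞) ≤ ∞ := fun m ↦ by exact_mod_cast le_top
    show ‖iteratedFDeriv ℝ (n' + 2) (fun y ↦ y + ∑ i, ψ i y • G i y) y‖ ≤ _
    rw [fun_iteratedFDeriv_add_apply (f := fun y : E ↦ y) (g := fun y ↦ ∑ i, ψ i y • G i y)
        contDiff_id.contDiffAt (hsum_s.of_le (hN _)).contDiffAt, hid0,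
      zero_add, iteratedFDeriv_fun_sum_apply fun i _ ↦ ((hTs i).of_le (hN _)).contDiffAt]
    exact (norm_sum_le _ _).trans (hsumterm y hy (n' + 2) (by omega) hnk)
  · -- locality near the `j`-th centre
    intro j y hyj
    have hloc : ∀ z, ‖P z - X j‖ < 2 * ϱ → Θ z = L j z + w j := by
      intro z hz
      have h0 : ∀ i, i ≠ j → ψ i z • G i z = 0 := by
        intro i hij
        have h16 := hsep i j hij
        have htri : ‖X i - X j‖ ≤ ‖X i - P z‖ + ‖P z - X j‖ := norm_sub_le_norm_sub_add_norm_sub _ _ _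
        rw [norm_sub_rev (X i) (P z)] at htri
        rw [hψzero i z (by linarith), zero_smul]
      show z + ∑ i, ψ i z • G i z = L j z + w j
      rw [Fintype.sum_eq_single j h0, hψone j z hz.le, one_smul]
      show z + (L j z + w j - z) = L j z + w j
      abel
    have hmem : {z | ‖P z - X j‖ < 2 * ϱ} ∈ 𝓝 y :=
      (isOpen_lt (P.continuous.sub continuous_const).norm continuous_const).mem_nhds
        (show ‖P y - X j‖ < 2 * ϱ by linarith)
    have hev : Θ =ᶠ[𝓝 y] fun z ↦ L j z + w j := mem_of_superset hmem fun z hz ↦ hloc z hz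
    refine ⟨?_, hloc y (by linarith)⟩
    rw [hev.fderiv_eq]
    exact ((L j).hasFDerivAt.add_const (w j)).fderiv

end Gluing

end Literature.Analysis.Calculus
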